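import Literature.NumberTheory.Automorphic.LocalUnitaryGroupCongrInner          -- ★ `conj_eq_conj_of_eq_mul_scalar`, `formCongr_scalar_eq_smul`, `cmDatumLocalCongr` (via `LocalUnitaryGroupCongr`)
import Literature.NumberTheory.Automorphic.IrreducibleClassesComapInner         -- ★ `IrrClass.comap_eq_comap_of_forall_eq_conj`, `IrrClass.comap_eq_self_of_forall_eq_conj`
import Literature.NumberTheory.Automorphic.UnitaryGroupFormCongrFinSum          -- ★ `formCongr_mul_eq`, `formCongr_smul_eq`
import HarnessLib

/-!
# R90-TF · S4 (Rogawski Ch. 13.1–2) — similitudes in the SAME NORM CLASS induce the SAME map on `Irr(U(H)(L⁺_v))`;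
# inner similitudes fix every class

Cell `hodgecm-mathlib`, crux H413 (`stmt-HodgeConjecture-24833`, lane `--supports`), route of record `HCCMUnconditional` (no route
verbs; count-neutral).  Programme R90-TF (brief `director/R90-BRIEF.v2.md`), section S4 = Ch. 13.1–2 (base `R90-C131`); seat R90-C131-p03
(g0), dealt BY NAME «p03 → S4#B4 `stub_R90_S4_H_card`, helper F1 `R90S4InnerSimilFixesClass`» (DEAL-S4-WAVE1, K2E2-plan (g6) ∕ DEAL-S4B-WAVE1,
R90-C131-typ2 (g0)).  THEOREMS ONLY (no `def`, no instance, no notation, no named fact, no `sorry`); imports ★ only.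
HONEST LABEL: HC_CM is proved only modulo the 7 printed citations (2 remaining named inputs: hLiu418 = stmt-HodgeConjecture-24832,
h413 = stmt-HodgeConjecture-24833) until rung 0 closes; this file is unconditional local group theory.

SETTING (★ `LocalUnitaryGroupCongr` §4): `L` CM, `F = L⁺`, `v` a finite place of `L⁺`, `E_v = L ⊗ L⁺_v` (★ `LocalRing L v`) with
`σ = c ⊗ 1` (★ `conjLocal`), hermitian matrices `H, H′ ∈ M_N(L)`, and LOCAL SIMILITUDES `T ∈ GL_N(E_v)` from `H′` to `H`:
`ᵗσ(T) · H_v · T = a • H′_v` with `a` a unit (★ `cmDatumLocalCongr L v T ha h : U(H′)(L⁺_v) ≃ₜ* U(H)(L⁺_v)`, `g ↦ T g T⁻¹`).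
Print: «An L-packet on `G` [= `U(2)`] is, by definition, a `PGL₂(F)`-orbit in `E(G)`» [Rogawski1990, §11.1 p. 161]; the
`PGL₂(F) = G_ad(F)`-action is realised by similitudes, and the kernel of `GU(Φ)(F) → Aut(E(G))` contains `E^× · U(Φ)(F)` — the
similitudes whose multiplier is a NORM `σ(z) z`.  This file is that kernel statement, for any rank `N` and any pair `H, H′`:

* §1 `exists_cmDatumLocalCongr_eq_conj_of_eq_norm_mul` — if two similitudes `T₁, T₂` (multipliers `a₁, a₂`) have
  `a₂ = σ(z) z · a₁` for a unit `z`, then `T₂ g T₂⁻¹ = u · (T₁ g T₁⁻¹) · u⁻¹` for ONE `u ∈ U(H)(L⁺_v)` and all `g ∈ U(H′)(L⁺_v)`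
  (`u := T₂ T₁⁻¹ (z • 1)⁻¹` preserves `H_v`; the scalar is central, ★ `conj_eq_conj_of_eq_mul_scalar`);
* §2 `comap_cmDatumLocalCongr_eq_of_eq_norm_mul` — hence the pull-backs `Irr(U(H)_v) → Irr(U(H′)_v)` along `T₁` and `T₂`
  COINCIDE (★ `IrrClass.comap_eq_comap_of_forall_eq_conj`: `π(u)` intertwines);
* §3 `comap_cmDatumLocalCongr_eq_self_of_coe` — THE DEALT NAME-SHAPE «INNER SIMILITUDES FIX EVERY CLASS»: for `T = u ∈ U(H)(L⁺_v)`
  (any recorded multiplier) `IrrClass.comap (cmDatumLocalCongr L v u …) c = c` (★ `IrrClass.comap_eq_self_of_forall_eq_conj`), and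
  `comap_cmDatumLocalCongr_scalar_eq_self` — a central similitude `z • 1` fixes every class.
DEPENDENCY CUT (CENSUS-FIRST, LEAD #12 (2)): nothing beneath — ★-closed today.

## References
* [Rogawski1990] J. D. Rogawski, *Automorphic Representations of Unitary Groups in Three Variables*, Ann. of Math. Stud. 123 (1990):
  §11.1 p. 161 (L-packets on `U(2)` as `PGL₂(F)`-orbits), §3.5 Lemma 3.5.3 (a) p. 28, §14.2 pp. 233–234.
* [PlatonovRapinchuk1994] V. Platonov, A. Rapinchuk, *Algebraic Groups and Number Theory* (1994), §2.3 (similitudes and unitary groups).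
* [BushnellHenniart2006] C. J. Bushnell, G. Henniart, *The Local Langlands Conjecture for GL(2)* (2006), §1.1 (`Irr(G)`; `π ∘ Ad(u) ≅ π`).
-/

set_option autoImplicit false
-- the mandated namespace repeats `HodgeConjecture.HodgeConjecture`, as in every `Theorems/*.lean` of this sub-problem
set_option linter.dupNamespace false

noncomputable section

open NumberField IsDedekindDomain
open scoped Matrix MatrixGroups

open Literature.NumberTheory.Automorphic Literature.NumberTheory.Automorphic.UnitaryGroup

namespace Summit.HodgeConjecture.HodgeConjecture.R90.S4

variable (L : Type) [Field L] [NumberField L] [IsCMField L] {N : ℕ}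

/-! ## §1 Two similitudes in the same norm class differ by `Ad(u)`, `u ∈ U(H)(L⁺_v)` -/

/-- **Similitudes in the same norm class differ by an inner automorphism.**  For local similitudes `ᵗσ(Tᵢ) · H_v · Tᵢ = aᵢ • H′_v`
(`i = 1, 2`) with `a₂ = σ(z) z · a₁` for a unit `z` of `L ⊗ L⁺_v`, the element `u := T₂ T₁⁻¹ (z • 1)⁻¹` lies in `U(H)(L⁺_v)` and
`T₂ g T₂⁻¹ = u · T₁ g T₁⁻¹ · u⁻¹` for every `g ∈ U(H′)(L⁺_v)` (the scalar `z • 1` is central).  This is the statement «`E^× · U(Φ)`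
acts trivially on `E(G)`» behind «an L-packet is a `PGL₂(F)`-orbit». [cite: Rogawski1990, §11.1 p. 161; §3.5 Lemma 3.5.3 (a) p. 28]
[cite: PlatonovRapinchuk1994, §2.3] -/
theorem exists_cmDatumLocalCongr_eq_conj_of_eq_norm_mul {H H' : Matrix (Fin N) (Fin N) L}
    (v : HeightOneSpectrum (𝓞 ↥(maximalRealSubfield L))) (T₁ T₂ : GL (Fin N) (LocalRing L v)) {a₁ a₂ : LocalRing L v}
    (ha₁ : IsUnit a₁) (ha₂ : IsUnit a₂)
    (h₁ : formCongr (conjLocal L (IsCMField.complexConj L) v) T₁ (H.map (algebraMap L (LocalRing L v))) =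
      a₁ • H'.map (algebraMap L (LocalRing L v)))
    (h₂ : formCongr (conjLocal L (IsCMField.complexConj L) v) T₂ (H.map (algebraMap L (LocalRing L v))) =
      a₂ • H'.map (algebraMap L (LocalRing L v)))
    {z : LocalRing L v} (hz : IsUnit z) (hzz : a₂ = conjLocal L (IsCMField.complexConj L) v z * z * a₁) :
    ∃ u : (cmDatum L N H).Local v, ∀ g : (cmDatum L N H').Local v,
      cmDatumLocalCongr L v T₂ ha₂ h₂ g = u * cmDatumLocalCongr L v T₁ ha₁ h₁ g * u⁻¹ := by
  set σ := conjLocal L (IsCMField.complexConj L) v with hσdef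
  set Hv : Matrix (Fin N) (Fin N) (LocalRing L v) := H.map (algebraMap L (LocalRing L v)) with hHvdef
  set H'v : Matrix (Fin N) (Fin N) (LocalRing L v) := H'.map (algebraMap L (LocalRing L v)) with hH'vdef
  -- the scalar frame `Z = z • 1` and the candidate `u₀ := T₂ T₁⁻¹ Z⁻¹`
  set Z : GL (Fin N) (LocalRing L v) :=
    Units.map ((Matrix.scalar (Fin N) : LocalRing L v →+* Matrix (Fin N) (Fin N) (LocalRing L v)) :
      LocalRing L v →* Matrix (Fin N) (Fin N) (LocalRing L v)) hz.unit with hZdef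
  set u₀ : GL (Fin N) (LocalRing L v) := T₂ * T₁⁻¹ * Z⁻¹ with hu₀def
  -- `ᵗσ(T₁⁻¹) · H′_v · T₁⁻¹ = a₁⁻¹ • H_v`
  have hback : formCongr σ T₁⁻¹ H'v = (↑ha₁.unit⁻¹ : LocalRing L v) • Hv := by
    have e1 : formCongr σ T₁⁻¹ (a₁ • H'v) = Hv := by rw [← h₁, formCongr_inv_formCongr]
    rw [formCongr_smul_eq] at e1
    rw [← e1, smul_smul, ha₁.val_inv_mul, one_smul]
  -- `Z⁻¹` is the scalar frame of `z⁻¹`, with `formCongr Z⁻¹ X = σ(z⁻¹) z⁻¹ • X`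
  have hZinv : Z⁻¹ = Units.map ((Matrix.scalar (Fin N) : LocalRing L v →+* Matrix (Fin N) (Fin N) (LocalRing L v)) :
      LocalRing L v →* Matrix (Fin N) (Fin N) (LocalRing L v)) (hz.unit⁻¹) := by
    rw [hZdef, map_inv]
  -- the norm bookkeeping: `σ(z⁻¹) z⁻¹ · a₂ · a₁⁻¹ = 1`
  have hnorm : σ (↑hz.unit⁻¹ : LocalRing L v) * ↑hz.unit⁻¹ * (a₂ * ↑ha₁.unit⁻¹) = 1 := by
    rw [hzz]
    have hzi : σ (↑hz.unit⁻¹ : LocalRing L v) * σ z = 1 := by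
      rw [← map_mul, hz.val_inv_mul, map_one]
    calc σ (↑hz.unit⁻¹ : LocalRing L v) * ↑hz.unit⁻¹ * (σ z * z * a₁ * ↑ha₁.unit⁻¹)
        = (σ (↑hz.unit⁻¹ : LocalRing L v) * σ z) * ((↑hz.unit⁻¹ : LocalRing L v) * z) * (a₁ * ↑ha₁.unit⁻¹) := by ring
      _ = 1 := by rw [hzi, hz.val_inv_mul, ha₁.mul_val_inv, one_mul, one_mul]
  -- `u₀` preserves `H_v`
  have hu₀ : u₀ ∈ «local» L (IsCMField.complexConj L) N H v := by
    rw [local_eq_unitaryGroupOfForm_map, mem_unitaryGroupOfForm_iff]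
    change formCongr σ u₀ Hv = Hv
    rw [hu₀def, formCongr_mul_eq, formCongr_mul_eq, h₂, formCongr_smul_eq, hback, smul_smul, hZinv,
      formCongr_scalar_eq_smul, smul_smul, hnorm, one_smul]
  -- `T₂ T₁⁻¹ = u₀ · Z`
  have hS : T₂ * T₁⁻¹ = u₀ * Z := by rw [hu₀def, inv_mul_cancel_right]
  refine ⟨⟨u₀, hu₀⟩, fun g => Subtype.ext ?_⟩
  change T₂ * g.val * T₂⁻¹ = u₀ * (T₁ * g.val * T₁⁻¹) * u₀⁻¹
  rw [← conj_eq_conj_of_eq_mul_scalar hS (T₁ * g.val * T₁⁻¹), mul_inv_rev, inv_inv]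
  simp only [mul_assoc, inv_mul_cancel_left]

/-! ## §2 … hence they induce the same map `Irr(U(H)(L⁺_v)) → Irr(U(H′)(L⁺_v))` -/

/-- **Similitudes in the same norm class pull back classes identically**: with the data of §1,
`IrrClass.comap (Ad T₁) c = IrrClass.comap (Ad T₂) c` for every `c ∈ Irr(U(H)(L⁺_v))` — `π(u)` intertwines `π ∘ Ad(T₁)` with
`π ∘ Ad(T₂) = π ∘ Ad(u) ∘ Ad(T₁)` (★ `IrrClass.comap_eq_comap_of_forall_eq_conj`).  In print's words: the orbit map
`GU(Φ)(F) → E(G)`, `T ↦ σ ∘ Ad(T)`, factors through the multiplier class in `F^× ∕ N E^×`. [cite: Rogawski1990, §11.1 p. 161]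
[cite: BushnellHenniart2006, §1.1] -/
theorem comap_cmDatumLocalCongr_eq_of_eq_norm_mul {H H' : Matrix (Fin N) (Fin N) L}
    (v : HeightOneSpectrum (𝓞 ↥(maximalRealSubfield L))) (T₁ T₂ : GL (Fin N) (LocalRing L v)) {a₁ a₂ : LocalRing L v}
    (ha₁ : IsUnit a₁) (ha₂ : IsUnit a₂)
    (h₁ : formCongr (conjLocal L (IsCMField.complexConj L) v) T₁ (H.map (algebraMap L (LocalRing L v))) =
      a₁ • H'.map (algebraMap L (LocalRing L v)))
    (h₂ : formCongr (conjLocal L (IsCMField.complexConj L) v) T₂ (H.map (algebraMap L (LocalRing L v))) =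
      a₂ • H'.map (algebraMap L (LocalRing L v)))
    {z : LocalRing L v} (hz : IsUnit z) (hzz : a₂ = conjLocal L (IsCMField.complexConj L) v z * z * a₁)
    (c : IrrClass ((cmDatum L N H).Local v)) :
    IrrClass.comap (cmDatumLocalCongr L v T₁ ha₁ h₁) c = IrrClass.comap (cmDatumLocalCongr L v T₂ ha₂ h₂) c := by
  obtain ⟨u, hu⟩ := exists_cmDatumLocalCongr_eq_conj_of_eq_norm_mul L v T₁ T₂ ha₁ ha₂ h₁ h₂ hz hzz
  exact IrrClass.comap_eq_comap_of_forall_eq_conj _ _ u hu c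

/-! ## §3 Inner similitudes and central similitudes fix every class -/

/-- **INNER SIMILITUDES FIX EVERY CLASS** (the dealt F1 of road «ORBIT COUNT», S4#B4): for `u ∈ U(H)(L⁺_v)` read as a similitude
of `H_v` with any recorded unit multiplier `a` (necessarily `ᵗσ(u) H_v u = H_v`, so `a • H_v = H_v`), the pull-back along
`Ad(u) : U(H)(L⁺_v) ≃ₜ* U(H)(L⁺_v)` is the identity of `Irr(U(H)(L⁺_v))`: «`π ∘ Ad(u) ≅ π` via `π(u)`»
(★ `IrrClass.comap_eq_self_of_forall_eq_conj`). [cite: Rogawski1990, §11.1 p. 161] [cite: BushnellHenniart2006, §1.1] -/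
theorem comap_cmDatumLocalCongr_eq_self_of_coe {H : Matrix (Fin N) (Fin N) L}
    (v : HeightOneSpectrum (𝓞 ↥(maximalRealSubfield L))) (u : (cmDatum L N H).Local v) {a : LocalRing L v} (ha : IsUnit a)
    (h : formCongr (conjLocal L (IsCMField.complexConj L) v) u.val (H.map (algebraMap L (LocalRing L v))) =
      a • H.map (algebraMap L (LocalRing L v)))
    (c : IrrClass ((cmDatum L N H).Local v)) :
    IrrClass.comap (cmDatumLocalCongr L v u.val ha h) c = c :=
  IrrClass.comap_eq_self_of_forall_eq_conj _ u (fun _ => Subtype.ext rfl) c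

/-- **CENTRAL SIMILITUDES FIX EVERY CLASS**: the scalar frame `z • 1` (`z` a unit of `L ⊗ L⁺_v`; multiplier `σ(z) z`) acts as the
identity on `U(H′)(L⁺_v)`, so its pull-back (to whatever unit multiplier `a` it is recorded with) agrees with that of `T = 1`
recorded with multiplier `a₁` whenever `a = σ(z) z · a₁` — the case `T₁ = 1`, `T₂ = z • 1` of §2. [cite: Rogawski1990, §11.1 p. 161]
[cite: PlatonovRapinchuk1994, §2.3] -/
theorem comap_cmDatumLocalCongr_scalar_eq {H H' : Matrix (Fin N) (Fin N) L}
    (v : HeightOneSpectrum (𝓞 ↥(maximalRealSubfield L))) {z : LocalRing L v} (hz : IsUnit z) {a₁ a : LocalRing L v}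
    (ha₁ : IsUnit a₁) (ha : IsUnit a)
    (h₁ : formCongr (conjLocal L (IsCMField.complexConj L) v) (1 : GL (Fin N) (LocalRing L v))
      (H.map (algebraMap L (LocalRing L v))) = a₁ • H'.map (algebraMap L (LocalRing L v)))
    (h : formCongr (conjLocal L (IsCMField.complexConj L) v)
      (Units.map ((Matrix.scalar (Fin N) : LocalRing L v →+* Matrix (Fin N) (Fin N) (LocalRing L v)) :
        LocalRing L v →* Matrix (Fin N) (Fin N) (LocalRing L v)) hz.unit)
      (H.map (algebraMap L (LocalRing L v))) = a • H'.map (algebraMap L (LocalRing L v)))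
    (hzz : a = conjLocal L (IsCMField.complexConj L) v z * z * a₁)
    (c : IrrClass ((cmDatum L N H).Local v)) :
    IrrClass.comap (cmDatumLocalCongr L v _ ha h) c = IrrClass.comap (cmDatumLocalCongr L v 1 ha₁ h₁) c :=
  (comap_cmDatumLocalCongr_eq_of_eq_norm_mul L v 1 _ ha₁ ha h₁ h hz hzz c).symm

end Summit.HodgeConjecture.HodgeConjecture.R90.S4

end
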